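import Literature.NumberTheory.EllipticCurves.PointCountEulerCriterion

/-!
# Frobenius (isogeny-character) certificates for Kenku's levels `45 = 3²·5`, `63 = 3²·7`, `81 = 3⁴`
# from the genus-one tables `X₀(15)`, `X₀(21)`, `X₀(27)`

Topic `NumberTheory/EllipticCurves`; theorems only (kernel-decided data). Companion of
`RationalIsogenyFrobeniusCertificates11/17/19and37/CM.lean` (see there for the mechanism: Mazur
1978, Prop. 6.3 (1), tree theorem `Mazur1978.isogenyCharacter_sq_sub_frobeniusTrace_mul_add_eq_zero`,
in its prime-power-modulus form for a `Γ_ℚ`-stable cyclic subgroup). The finite tables used here are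
the non-cuspidal rational points of the genus-one curves `X₀(15)` (`ν = 4`:
`j = -5²/2, -5²·241³/2³, -5·29³/2⁵, 5·211³/2¹⁵`), `X₀(21)` (`ν = 4`:
`j = -3²·5⁶/2³, 3³·5³/2, -3²·5³·101³/2²¹, -3³·5³·383³/2⁷`) and `X₀(27)` (`ν = 1`: `j = -2¹⁵·3·5³`,
CM by the order of discriminant `-27`) — Mazur 1978, table p. 129 (after Ligozat 1975); Kenku 1982
p. 200. A cyclic `45`- (resp. `63`-, `81`-) isogeny out of `E` gives a cyclic `15`- (resp. `21`-,
`27`-) isogeny out of `E`, so `j(E)` is in the table, and a `Γ_ℚ`-stable cyclic subgroup of order `9`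
(resp. `9`, `81`), whose character `r` would satisfy `r(φ_ℓ)² - a_ℓ r(φ_ℓ) + ℓ ≡ 0` modulo `9`
(resp. `9`, `81`) at every good `ℓ ∤ 3`; at the witness prime `ℓ = 7` the polynomial has no root.
(Modulo `3` there always is a root: these curves do carry rational `3`-isogenies.) Models: minimal
quadratic twists (conductors `50`, `162`, `27`), globally minimal.

## References

* B. Mazur, *Rational isogenies of prime degree*, Invent. Math. 44 (1978): table p. 129, Prop. 6.3 (1). [Mazur1978]
* M. A. Kenku, J. Number Theory 15 (1982) 199–202, proof of Thm. 1. [Kenku1982]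
* G. Ligozat, *Courbes modulaires de genre 1*, Mém. SMF 43 (1975). [Ligozat1975]
-/

namespace Literature.NumberTheory.EllipticCurves.KenkuLevelsCert

open Literature.NumberTheory.EllipticCurves

/-- `#Ẽ(𝔽_7) = 6`, i.e. `a_7 = 2`, for `E = [1, 0, 1, -1, -2]` (`j = -25/2`; table `X₀(15)`, minimal
discriminant `-1250`); witness prime for the level `45`. [folklore] -/
theorem card_E15_jm25d2_7 :
    Nat.card (((⟨1, 0, 1, -1, -2⟩ : WeierstrassCurve ℤ).map (Int.castRingHom (ZMod 7))).toAffine.Point) = 6 := by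
  rw [@WeierstrassCurve.natCard_point_eq_one_add_card (ZMod 7) (@ZMod.instField 7 ⟨by norm_num⟩) _ _ _
    (by decide +kernel), @card_sol_eq_sum_euler (ZMod 7) (@ZMod.instField 7 ⟨by norm_num⟩) _ _
    (by rw [ZMod.ringChar_zmod_n]; decide), ZMod.card]
  decide +kernel

/-- Level `45`: `X² - a_7X + 7 = X² - (2)X + 7` has no root modulo `9` (no `Γ_ℚ`-stable cyclic
subgroup of order `9` on (a twist of) `E_j`, hence no rational cyclic `45`-isogeny). [folklore] -/
theorem noroot_E15_jm25d2_7_9 : ∀ t : ZMod 9, t ^ 2 - (2 : ZMod 9) * t + 7 ≠ 0 := by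
  decide +kernel

/-- `#Ẽ(𝔽_7) = 6`, i.e. `a_7 = 2`, for `E = [1, 0, 1, -126, -552]` (`j = -349938025/8`; table `X₀(15)`, minimal
discriminant `-5000`); witness prime for the level `45`. [folklore] -/
theorem card_E15_jm349938025d8_7 :
    Nat.card (((⟨1, 0, 1, -126, -552⟩ : WeierstrassCurve ℤ).map (Int.castRingHom (ZMod 7))).toAffine.Point) = 6 := by
  rw [@WeierstrassCurve.natCard_point_eq_one_add_card (ZMod 7) (@ZMod.instField 7 ⟨by norm_num⟩) _ _ _
    (by decide +kernel), @card_sol_eq_sum_euler (ZMod 7) (@ZMod.instField 7 ⟨by norm_num⟩) _ _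
    (by rw [ZMod.ringChar_zmod_n]; decide), ZMod.card]
  decide +kernel

/-- Level `45`: `X² - a_7X + 7 = X² - (2)X + 7` has no root modulo `9` (no `Γ_ℚ`-stable cyclic
subgroup of order `9` on (a twist of) `E_j`, hence no rational cyclic `45`-isogeny). [folklore] -/
theorem noroot_E15_jm349938025d8_7_9 : ∀ t : ZMod 9, t ^ 2 - (2 : ZMod 9) * t + 7 ≠ 0 := by
  decide +kernel

/-- `#Ẽ(𝔽_7) = 10`, i.e. `a_7 = -2`, for `E = [1, 1, 1, -3, 1]` (`j = -121945/32`; table `X₀(15)`, minimal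
discriminant `-800`); witness prime for the level `45`. [folklore] -/
theorem card_E15_jm121945d32_7 :
    Nat.card (((⟨1, 1, 1, -3, 1⟩ : WeierstrassCurve ℤ).map (Int.castRingHom (ZMod 7))).toAffine.Point) = 10 := by
  rw [@WeierstrassCurve.natCard_point_eq_one_add_card (ZMod 7) (@ZMod.instField 7 ⟨by norm_num⟩) _ _ _
    (by decide +kernel), @card_sol_eq_sum_euler (ZMod 7) (@ZMod.instField 7 ⟨by norm_num⟩) _ _
    (by rw [ZMod.ringChar_zmod_n]; decide), ZMod.card]
  decide +kernel

/-- Level `45`: `X² - a_7X + 7 = X² - (-2)X + 7` has no root modulo `9` (no `Γ_ℚ`-stable cyclic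
subgroup of order `9` on (a twist of) `E_j`, hence no rational cyclic `45`-isogeny). [folklore] -/
theorem noroot_E15_jm121945d32_7_9 : ∀ t : ZMod 9, t ^ 2 - (-2 : ZMod 9) * t + 7 ≠ 0 := by
  decide +kernel

/-- `#Ẽ(𝔽_7) = 10`, i.e. `a_7 = -2`, for `E = [1, 1, 1, 22, -9]` (`j = 46969655/32768`; table `X₀(15)`, minimal
discriminant `-819200`); witness prime for the level `45`. [folklore] -/
theorem card_E15_j46969655d32768_7 :
    Nat.card (((⟨1, 1, 1, 22, -9⟩ : WeierstrassCurve ℤ).map (Int.castRingHom (ZMod 7))).toAffine.Point) = 10 := by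
  rw [@WeierstrassCurve.natCard_point_eq_one_add_card (ZMod 7) (@ZMod.instField 7 ⟨by norm_num⟩) _ _ _
    (by decide +kernel), @card_sol_eq_sum_euler (ZMod 7) (@ZMod.instField 7 ⟨by norm_num⟩) _ _
    (by rw [ZMod.ringChar_zmod_n]; decide), ZMod.card]
  decide +kernel

/-- Level `45`: `X² - a_7X + 7 = X² - (-2)X + 7` has no root modulo `9` (no `Γ_ℚ`-stable cyclic
subgroup of order `9` on (a twist of) `E_j`, hence no rational cyclic `45`-isogeny). [folklore] -/
theorem noroot_E15_j46969655d32768_7_9 : ∀ t : ZMod 9, t ^ 2 - (-2 : ZMod 9) * t + 7 ≠ 0 := by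
  decide +kernel

/-- `#Ẽ(𝔽_7) = 6`, i.e. `a_7 = 2`, for `E = [1, -1, 1, -5, 5]` (`j = -140625/8`; table `X₀(21)`, minimal
discriminant `-648`); witness prime for the level `63`. [folklore] -/
theorem card_E21_jm140625d8_7 :
    Nat.card (((⟨1, -1, 1, -5, 5⟩ : WeierstrassCurve ℤ).map (Int.castRingHom (ZMod 7))).toAffine.Point) = 6 := by
  rw [@WeierstrassCurve.natCard_point_eq_one_add_card (ZMod 7) (@ZMod.instField 7 ⟨by norm_num⟩) _ _ _
    (by decide +kernel), @card_sol_eq_sum_euler (ZMod 7) (@ZMod.instField 7 ⟨by norm_num⟩) _ _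
    (by rw [ZMod.ringChar_zmod_n]; decide), ZMod.card]
  decide +kernel

/-- Level `63`: `X² - a_7X + 7 = X² - (2)X + 7` has no root modulo `9` (no `Γ_ℚ`-stable cyclic
subgroup of order `9` on (a twist of) `E_j`, hence no rational cyclic `63`-isogeny). [folklore] -/
theorem noroot_E21_jm140625d8_7_9 : ∀ t : ZMod 9, t ^ 2 - (2 : ZMod 9) * t + 7 ≠ 0 := by
  decide +kernel

/-- `#Ẽ(𝔽_7) = 6`, i.e. `a_7 = 2`, for `E = [1, -1, 0, 3, -1]` (`j = 3375/2`; table `X₀(21)`, minimal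
discriminant `-1458`); witness prime for the level `63`. [folklore] -/
theorem card_E21_j3375d2_7 :
    Nat.card (((⟨1, -1, 0, 3, -1⟩ : WeierstrassCurve ℤ).map (Int.castRingHom (ZMod 7))).toAffine.Point) = 6 := by
  rw [@WeierstrassCurve.natCard_point_eq_one_add_card (ZMod 7) (@ZMod.instField 7 ⟨by norm_num⟩) _ _ _
    (by decide +kernel), @card_sol_eq_sum_euler (ZMod 7) (@ZMod.instField 7 ⟨by norm_num⟩) _ _
    (by rw [ZMod.ringChar_zmod_n]; decide), ZMod.card]
  decide +kernel

/-- Level `63`: `X² - a_7X + 7 = X² - (2)X + 7` has no root modulo `9` (no `Γ_ℚ`-stable cyclic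
subgroup of order `9` on (a twist of) `E_j`, hence no rational cyclic `63`-isogeny). [folklore] -/
theorem noroot_E21_j3375d2_7_9 : ∀ t : ZMod 9, t ^ 2 - (2 : ZMod 9) * t + 7 ≠ 0 := by
  decide +kernel

/-- `#Ẽ(𝔽_7) = 6`, i.e. `a_7 = 2`, for `E = [1, -1, 1, -95, -697]` (`j = -1159088625/2097152`; table `X₀(21)`, minimal
discriminant `-169869312`); witness prime for the level `63`. [folklore] -/
theorem card_E21_jm1159088625d2097152_7 :
    Nat.card (((⟨1, -1, 1, -95, -697⟩ : WeierstrassCurve ℤ).map (Int.castRingHom (ZMod 7))).toAffine.Point) = 6 := by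
  rw [@WeierstrassCurve.natCard_point_eq_one_add_card (ZMod 7) (@ZMod.instField 7 ⟨by norm_num⟩) _ _ _
    (by decide +kernel), @card_sol_eq_sum_euler (ZMod 7) (@ZMod.instField 7 ⟨by norm_num⟩) _ _
    (by rw [ZMod.ringChar_zmod_n]; decide), ZMod.card]
  decide +kernel

/-- Level `63`: `X² - a_7X + 7 = X² - (2)X + 7` has no root modulo `9` (no `Γ_ℚ`-stable cyclic
subgroup of order `9` on (a twist of) `E_j`, hence no rational cyclic `63`-isogeny). [folklore] -/
theorem noroot_E21_jm1159088625d2097152_7_9 : ∀ t : ZMod 9, t ^ 2 - (2 : ZMod 9) * t + 7 ≠ 0 := by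
  decide +kernel

/-- `#Ẽ(𝔽_7) = 6`, i.e. `a_7 = 2`, for `E = [1, -1, 0, -1077, 13877]` (`j = -189613868625/128`; table `X₀(21)`, minimal
discriminant `-93312`); witness prime for the level `63`. [folklore] -/
theorem card_E21_jm189613868625d128_7 :
    Nat.card (((⟨1, -1, 0, -1077, 13877⟩ : WeierstrassCurve ℤ).map (Int.castRingHom (ZMod 7))).toAffine.Point) = 6 := by
  rw [@WeierstrassCurve.natCard_point_eq_one_add_card (ZMod 7) (@ZMod.instField 7 ⟨by norm_num⟩) _ _ _
    (by decide +kernel), @card_sol_eq_sum_euler (ZMod 7) (@ZMod.instField 7 ⟨by norm_num⟩) _ _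
    (by rw [ZMod.ringChar_zmod_n]; decide), ZMod.card]
  decide +kernel

/-- Level `63`: `X² - a_7X + 7 = X² - (2)X + 7` has no root modulo `9` (no `Γ_ℚ`-stable cyclic
subgroup of order `9` on (a twist of) `E_j`, hence no rational cyclic `63`-isogeny). [folklore] -/
theorem noroot_E21_jm189613868625d128_7_9 : ∀ t : ZMod 9, t ^ 2 - (2 : ZMod 9) * t + 7 ≠ 0 := by
  decide +kernel

/-- `#Ẽ(𝔽_7) = 9`, i.e. `a_7 = -1`, for `E = [0, 0, 1, -30, 63]` (`j = -12288000`; table `X₀(27)`, minimal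
discriminant `-243`); witness prime for the level `81`. [folklore] -/
theorem card_E27_jm12288000_7 :
    Nat.card (((⟨0, 0, 1, -30, 63⟩ : WeierstrassCurve ℤ).map (Int.castRingHom (ZMod 7))).toAffine.Point) = 9 := by
  rw [@WeierstrassCurve.natCard_point_eq_one_add_card (ZMod 7) (@ZMod.instField 7 ⟨by norm_num⟩) _ _ _
    (by decide +kernel), @card_sol_eq_sum_euler (ZMod 7) (@ZMod.instField 7 ⟨by norm_num⟩) _ _
    (by rw [ZMod.ringChar_zmod_n]; decide), ZMod.card]
  decide +kernel

/-- Level `81`: `X² - a_7X + 7 = X² - (-1)X + 7` has no root modulo `81` (no `Γ_ℚ`-stable cyclic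
subgroup of order `81` on (a twist of) `E_j`, hence no rational cyclic `81`-isogeny). [folklore] -/
theorem noroot_E27_jm12288000_7_81 : ∀ t : ZMod 81, t ^ 2 - (-1 : ZMod 81) * t + 7 ≠ 0 := by
  decide +kernel

end Literature.NumberTheory.EllipticCurves.KenkuLevelsCert
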